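import Summits.NavierStokesRegularity.NavierStokesRegularity.Theorems.PerpetualPumpCircuitPumpActiveClock

/-!
# `PerpetualPump.CircuitPump` (stmt-NavierStokesRegularity-1834), line `singular-clock-gspt`:
# window numerics of the Toda clock box — elementary lemmas

Helper estimates for the sub-goal `toda_clockBox_window` of `stub_clockBox` (Toda `m = 2` instance):
the elementary bounds `x ≤ -log (1 - x) ≤ x/(1 - x)`, the explicit window half-widths
`Δ = -(1/ν) log (1 - ν c/(lam W))`, and the pointwise sizes of `ℓ₁ = Λ/2 + log (A/8)`,
`x = (ℓ₁ + 11/5)/A`, `W∓ = A - ℓ₁ ∓ (903 + 50 log A)`, `c⁻ = Λ/2 - log q - 28 log A - 449`,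
`c⁺ = Λ/2 - log q + 73` on the amplitude window `A ∈ [9A⋆/10, 11A⋆/10]`, `Λ = μ A⋆`,
`μ = 2(q-1)/(q+1) ≤ 0.0811`, under the largeness hypothesis `log A ≤ Λ/100000 - 500`.
Pure real arithmetic. [folklore]
-/

set_option linter.dupNamespace false

noncomputable section

namespace Summit.NavierStokesRegularity.NavierStokesRegularity.Theorems.PerpetualPumpCircuitPump

/-- For `0 ≤ x < 1`: `x ≤ -log (1 - x) ≤ x / (1 - x)`. [folklore] -/
theorem clockBox_neglog {x : ℝ} (hx1 : x < 1) :
    x ≤ -Real.log (1 - x) ∧ -Real.log (1 - x) ≤ x / (1 - x) := by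
  have h1 : 0 < 1 - x := by linarith
  refine ⟨by have := Real.log_le_sub_one_of_pos h1; linarith, ?_⟩
  have h2 := Real.log_le_sub_one_of_pos (inv_pos.mpr h1)
  rw [Real.log_inv] at h2
  have h3 : (1 - x)⁻¹ - 1 = x / (1 - x) := by field_simp; ring
  linarith

/-- Monotonicity of `x ↦ -log (1 - x)` below `1`. [folklore] -/
theorem clockBox_neglog_mono {x x' : ℝ} (hxx' : x ≤ x') (hx1 : x' < 1) :
    -Real.log (1 - x) ≤ -Real.log (1 - x') := by
  have := Real.log_le_log (by linarith : 0 < 1 - x') (by linarith : 1 - x' ≤ 1 - x)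
  linarith

/-- The gate time `τ = -log (1 - x)` for `0 ≤ x ≤ 0.0451`: `0 ≤ x ≤ τ ≤ 1.0473 x`. [folklore] -/
theorem clockBox_tau {x : ℝ} (hx0 : 0 ≤ x) (hx1 : x ≤ 451 / 10000) :
    0 ≤ -Real.log (1 - x) ∧ x ≤ -Real.log (1 - x) ∧ -Real.log (1 - x) ≤ 10473 / 10000 * x := by
  obtain ⟨hl, hu⟩ := clockBox_neglog (by linarith : x < 1)
  refine ⟨by linarith, hl, hu.trans ?_⟩
  rw [div_le_iff₀ (by linarith)]
  nlinarith [mul_nonneg hx0 (by linarith : (0 : ℝ) ≤ 473 / 10000 - 10473 / 10000 * x)]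

/-- Monotonicity of the window half-width in `y`: `y ≤ y' < 1 ⟹ -(1/ν) log (1-y) ≤ -(1/ν) log (1-y')`.
[folklore] -/
theorem clockBox_delta_mono {ν y y' : ℝ} (hν : 0 < ν) (hyy' : y ≤ y') (hy' : y' < 1) :
    -(1 / ν) * Real.log (1 - y) ≤ -(1 / ν) * Real.log (1 - y') := by
  have h := clockBox_neglog_mono hyy' hy'
  have e : ∀ z : ℝ, -(1 / ν) * Real.log (1 - z) = (1 / ν) * (-Real.log (1 - z)) := fun z => by ring
  rw [e, e]; exact mul_le_mul_of_nonneg_left h (by positivity)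

/-- The explicit window half-width `Δ = -(1/ν) log (1 - ν c/(lam W))`: with
`y = ν c/(lam W) ≤ c/W ≤ 0.0473` one has `y < 1`, `0 ≤ Δ ≤ 1.0497 c/(lam W)`,
`c/(lam W) ≤ 0.0473`, and `Δ > 0` if `c > 0`. [folklore] -/
theorem clockBox_delta {lam ν W c : ℝ} (hν : 1 ≤ ν) (hνlam : ν ≤ lam) (hW : 0 < W) (hc : 0 ≤ c)
    (hcW : c ≤ 473 / 10000 * W) :
    ν * c / (lam * W) < 1 ∧ 0 ≤ -(1 / ν) * Real.log (1 - ν * c / (lam * W)) ∧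
    -(1 / ν) * Real.log (1 - ν * c / (lam * W)) ≤ 10497 / 10000 * (c / (lam * W)) ∧
    c / (lam * W) ≤ 473 / 10000 ∧
    (0 < c → 0 < -(1 / ν) * Real.log (1 - ν * c / (lam * W))) := by
  have hlam : 0 < lam := by linarith
  have hlW : 0 < lam * W := mul_pos hlam hW
  have hcw : c / (lam * W) ≤ 473 / 10000 := by
    rw [div_le_iff₀ hlW]; nlinarith
  have hy0 : 0 ≤ ν * c / (lam * W) := by positivity
  have hyc : ν * c / (lam * W) = ν * (c / (lam * W)) := mul_div_assoc _ _ _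
  have hy1 : ν * c / (lam * W) ≤ 473 / 10000 := by
    rw [div_le_iff₀ hlW]; nlinarith [mul_le_mul hνlam hcW hc hlam.le]
  have hylt : ν * c / (lam * W) < 1 := by linarith
  obtain ⟨hl, hu⟩ := clockBox_neglog hylt
  have e : -(1 / ν) * Real.log (1 - ν * c / (lam * W)) =
      (1 / ν) * (-Real.log (1 - ν * c / (lam * W))) := by ring
  refine ⟨hylt, ?_, ?_, hcw, ?_⟩
  · rw [e]; exact mul_nonneg (by positivity) (by linarith)
  · have h1 : -Real.log (1 - ν * c / (lam * W)) ≤ 10497 / 10000 * (ν * c / (lam * W)) := by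
      refine hu.trans ?_
      rw [div_le_iff₀ (by linarith)]
      nlinarith [mul_nonneg hy0
        (by linarith : (0 : ℝ) ≤ 497 / 10000 - 10497 / 10000 * (ν * c / (lam * W)))]
    rw [e]
    calc (1 / ν) * (-Real.log (1 - ν * c / (lam * W)))
        ≤ (1 / ν) * (10497 / 10000 * (ν * c / (lam * W))) :=
          mul_le_mul_of_nonneg_left h1 (by positivity)
      _ = 10497 / 10000 * (c / (lam * W)) := by rw [hyc]; field_simp
  · intro hc0
    have hy0' : 0 < ν * c / (lam * W) := by positivity
    have : Real.log (1 - ν * c / (lam * W)) < 0 := Real.log_neg (by linarith) (by linarith)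
    rw [e]; exact mul_pos (by positivity) (by linarith)

/-- Monotonicity of `W⁻ = A - ℓ₁ - 903 - 50 log A` in `A` on `[A₁, ∞)`, `A₁ ≥ 51`. [folklore] -/
theorem clockBox_Wmono {Λ A₁ A : ℝ} (h1 : 51 ≤ A₁) (h2 : A₁ ≤ A) :
    A₁ - (Λ / 2 + Real.log (A₁ / 8)) - 903 - 50 * Real.log A₁ ≤
      A - (Λ / 2 + Real.log (A / 8)) - 903 - 50 * Real.log A := by
  have hA₁ : 0 < A₁ := by linarith
  have hA : 0 < A := by linarith
  have e1 : Real.log (A / 8) = Real.log A - Real.log 8 := Real.log_div hA.ne' (by norm_num)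
  have e2 : Real.log (A₁ / 8) = Real.log A₁ - Real.log 8 := Real.log_div hA₁.ne' (by norm_num)
  have e3 : Real.log (A / A₁) = Real.log A - Real.log A₁ := Real.log_div hA.ne' hA₁.ne'
  have h3 := Real.log_le_sub_one_of_pos (div_pos hA hA₁)
  have h4 : A / A₁ - 1 = (A - A₁) / A₁ := by field_simp
  have h5 : 51 * ((A - A₁) / A₁) ≤ A - A₁ := by
    rw [mul_div_assoc', div_le_iff₀ hA₁]; nlinarith
  rw [e1, e2]; linarith

/-- The constants of the window: `1 < q ≤ 1.0845`, `A⋆ > 0`, `Λ > 0`, `Λ ≤ 0.0811 A⋆`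
(`μ = 2(q-1)/(q+1)`), `(q-1) A⋆ = (q+1) Λ/2`, `0 < A₁ ≤ A₂`, `log A₂ ≤ Λ/100000 - 500`, `ν ≤ lam`.
[folklore] -/
theorem clockBox_consts {lam ν q Λ As A₁ A₂ : ℝ} (hlam : 1 < lam) (hlam2 : lam ≤ 3 / 2)
    (hν : ν = lam ^ (4 / 5 : ℝ)) (hq : q = lam ^ (1 / 5 : ℝ))
    (hAs : As = (q + 1) * Λ / (2 * (q - 1))) (hA₁ : A₁ = 9 / 10 * As)
    (hA₂ : A₂ = 11 / 10 * As) (h40000 : 40000 ≤ A₁) (HBIG : 100000 * (Real.log A₂ + 500) ≤ Λ) :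
    1 < q ∧ q ≤ 2169 / 2000 ∧ 0 < As ∧ 0 < Λ ∧ Λ ≤ 811 / 10000 * As ∧
    (q - 1) * As = (q + 1) * Λ / 2 ∧ 0 < A₁ ∧ A₁ ≤ A₂ ∧ Real.log A₂ ≤ Λ / 100000 - 500 ∧
    ν ≤ lam := by
  have hlam0 : 0 < lam := by linarith
  have hq1 : 1 < q := by rw [hq]; exact Real.one_lt_rpow hlam (by norm_num)
  have hq2 : q ≤ 2169 / 2000 := by
    rw [hq, one_div, Real.rpow_inv_le_iff_of_pos hlam0.le (by norm_num) (by norm_num)]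
    have e : (2169 / 2000 : ℝ) ^ (5 : ℝ) = (2169 / 2000) ^ (5 : ℕ) := by
      rw [show (5 : ℝ) = ((5 : ℕ) : ℝ) by norm_num, Real.rpow_natCast]
    rw [e]; norm_num; linarith
  have hAs0 : 0 < As := by linarith
  have hA₂0 : 0 < A₂ := by linarith
  have hlogA₂ : 0 < Real.log A₂ := Real.log_pos (by linarith)
  have hΛ0 : 0 < Λ := by linarith
  have hq1' : q - 1 ≠ 0 := by linarith
  have hrel : (q - 1) * As = (q + 1) * Λ / 2 := by
    rw [hAs]; field_simp
  have h1 : 0 ≤ (q + 1) * (811 / 10000 * As - Λ) := by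
    have e : (q + 1) * (811 / 10000 * As - Λ) = As * (811 / 10000 * (q + 1) - 2 * (q - 1)) := by
      linear_combination 2 * hrel
    rw [e]; exact mul_nonneg hAs0.le (by linarith)
  have hΛAs : Λ ≤ 811 / 10000 * As := by
    have := (mul_nonneg_iff_of_pos_left (by linarith : 0 < q + 1)).mp h1
    linarith
  have hνlam : ν ≤ lam := by
    rw [hν]
    calc lam ^ (4 / 5 : ℝ) ≤ lam ^ (1 : ℝ) := Real.rpow_le_rpow_of_exponent_le hlam.le (by norm_num)
      _ = lam := Real.rpow_one lam
  exact ⟨hq1, hq2, hAs0, hΛ0, hΛAs, hrel, by linarith, by linarith, by linarith, hνlam⟩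

/-- `ε (A+2)² ≤ 1` and `√ε A ≤ 1/40` from `2 log (40 A) ≤ Λ = -log ε`. [folklore] -/
theorem clockBox_eps {ε Λ A : ℝ} (hε : 0 < ε) (hΛ : Λ = -Real.log ε) (hA : 40000 ≤ A)
    (hL : Real.log A ≤ Λ / 100000 - 500) :
    ε * (A + 2) ^ 2 ≤ 1 ∧ Real.sqrt ε * A ≤ 1 / 40 := by
  have hA0 : 0 < A := by linarith
  have hεexp : ε = Real.exp (-Λ) := by rw [hΛ, neg_neg, Real.exp_log hε]
  have hlogA : 0 < Real.log A := Real.log_pos (by linarith)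
  have hΛ0 : 0 < Λ := by linarith
  have h2 : Real.log 2 ≤ 1 := by
    have := Real.log_le_sub_one_of_pos (show (0 : ℝ) < 2 by norm_num); linarith
  have h40 : Real.log 40 ≤ 39 := by
    have := Real.log_le_sub_one_of_pos (show (0 : ℝ) < 40 by norm_num); linarith
  have hA2 : Real.log (A + 2) ≤ 1 + Real.log A := by
    calc Real.log (A + 2) ≤ Real.log (2 * A) := Real.log_le_log (by linarith) (by linarith)
      _ = Real.log 2 + Real.log A := Real.log_mul (by norm_num) hA0.ne'
      _ ≤ 1 + Real.log A := by linarith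
  constructor
  · have e : (A + 2) ^ 2 = Real.exp (2 * Real.log (A + 2)) := by
      rw [← Real.exp_log (by positivity : 0 < (A + 2) ^ 2), Real.log_pow]; norm_num
    rw [hεexp, e, ← Real.exp_add]
    calc Real.exp (-Λ + 2 * Real.log (A + 2)) ≤ Real.exp 0 := Real.exp_le_exp.mpr (by linarith)
      _ = 1 := Real.exp_zero
  · have hs : Real.sqrt ε = Real.exp (-Λ / 2) := by
      have e : Real.exp (-Λ) = Real.exp (-Λ / 2) ^ 2 := by rw [sq, ← Real.exp_add]; ring_nf
      rw [hεexp, e, Real.sqrt_sq (Real.exp_pos _).le]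
    calc Real.sqrt ε * A = Real.exp (-Λ / 2) * Real.exp (Real.log A) := by rw [hs, Real.exp_log hA0]
      _ = Real.exp (-Λ / 2 + Real.log A) := (Real.exp_add _ _).symm
      _ ≤ Real.exp (-Real.log 40) := Real.exp_le_exp.mpr (by linarith)
      _ = 1 / 40 := by rw [Real.exp_neg, Real.exp_log (by norm_num)]; norm_num

/-- **Pointwise sizes on the amplitude window.** For `A ∈ [9A⋆/10, 11A⋆/10]` with `Λ = μ A⋆`,
`0 < μ ≤ 0.0811`, `log A ≤ Λ/100000 - 500`: the ranges of `log A`, `x = (ℓ₁ + 11/5)/A`, `W∓`, `c∓`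
used by the window numerics. [folklore] -/
theorem clockBox_point :
    ∀ (q Λ As μ A : ℝ), 0 ≤ Real.log q → Real.log q ≤ 1 / 10 → 0 < As → Λ = μ * As → 0 < μ →
    μ ≤ 811 / 10000 → 9 / 10 * As ≤ A → A ≤ 11 / 10 * As → 40000 ≤ A →
    Real.log A ≤ Λ / 100000 - 500 →
    10 ≤ Real.log A ∧ 0 ≤ Real.log (A / 8) ∧ Real.log (A / 8) ≤ Real.log A ∧
    5 / 11 * μ ≤ ((Λ / 2 + Real.log (A / 8)) + 11 / 5) / A ∧
    ((Λ / 2 + Real.log (A / 8)) + 11 / 5) / A ≤ 5556 / 10000 * μ ∧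
    ((Λ / 2 + Real.log (A / 8)) + 11 / 5) / A ≤ 451 / 10000 ∧
    8594 / 10000 * As ≤ A - (Λ / 2 + Real.log (A / 8)) - 903 - 50 * Real.log A ∧
    A - (Λ / 2 + Real.log (A / 8)) + 903 + 50 * Real.log A ≤ 11 / 10 * As ∧
    0 < Λ / 2 - Real.log q - 28 * Real.log A - 449 ∧
    Λ / 2 - Real.log q + 73 ≤ 50001 / 100000 * Λ ∧
    Λ / 2 - Real.log q + 73 ≤
      473 / 10000 * (A - (Λ / 2 + Real.log (A / 8)) - 903 - 50 * Real.log A) ∧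
    1806 + 100 * Real.log A ≤ Λ / 1000 ∧ 250 + 16 * Real.log A ≤ 16 / 100000 * Λ := by
  intro q Λ As μ A hlq0 hlq1 hAs hμ hμ0 hμ1 hA1 hA2 h4 hL
  have hA0 : 0 < A := by linarith
  have hΛμ : Λ ≤ 811 / 10000 * As := by rw [hμ]; exact mul_le_mul_of_nonneg_right hμ1 hAs.le
  have hlogA : 10 ≤ Real.log A := by
    rw [Real.le_log_iff_exp_le hA0]
    have e : Real.exp (10 : ℝ) = Real.exp 1 ^ 10 := by
      rw [show (10 : ℝ) = ((10 : ℕ) : ℝ) * 1 by norm_num, Real.exp_nat_mul]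
    rw [e]
    calc Real.exp 1 ^ 10 ≤ (2.7182818286 : ℝ) ^ 10 :=
          pow_le_pow_left₀ (Real.exp_pos 1).le Real.exp_one_lt_d9.le 10
      _ ≤ 40000 := by norm_num
      _ ≤ A := h4
  have h8 : 0 ≤ Real.log (A / 8) := Real.log_nonneg (by linarith)
  have h8' : Real.log (A / 8) ≤ Real.log A := Real.log_le_log (by positivity) (by linarith)
  have hμA1 : μ * (9 / 10 * As) ≤ μ * A := mul_le_mul_of_nonneg_left hA1 hμ0.le
  have hμA2 : μ * A ≤ μ * (11 / 10 * As) := mul_le_mul_of_nonneg_left hA2 hμ0.le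
  have hx1 : 5 / 11 * μ ≤ ((Λ / 2 + Real.log (A / 8)) + 11 / 5) / A := by
    rw [le_div_iff₀ hA0]; nlinarith
  have hx2 : ((Λ / 2 + Real.log (A / 8)) + 11 / 5) / A ≤ 5556 / 10000 * μ := by
    rw [div_le_iff₀ hA0]; nlinarith
  have hx3 : ((Λ / 2 + Real.log (A / 8)) + 11 / 5) / A ≤ 451 / 10000 :=
    hx2.trans (by nlinarith)
  refine ⟨hlogA, h8, h8', hx1, hx2, hx3, ?_, ?_, ?_, ?_, ?_, ?_, ?_⟩
  · nlinarith
  · nlinarith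
  · nlinarith
  · nlinarith
  · nlinarith
  · nlinarith
  · nlinarith

/-- NO-SECOND-HOP MARGIN, abstract form: with `W⁺(A) ≤ 1.1 A⋆`, `τ♯ ≤ 0.5819 μ`, `π♯ ≤ 0.0002 μ`,
`τ(A) ≥ x(A) ≥ 5μ/11`, `Δ⁺(A₁) ≤ 1.0497 c⁺/(lam W⁻(A₁))`, `W⁻(A₁) ≥ 0.8594 A⋆`, `c⁺ ≤ 0.50001 Λ`:
`lam W⁺(A) (τ♯ + π♯ + Δ⁺(A₁) - t₃(A)) ≤ 0.9 Λ`. [folklore] -/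
theorem clockBox_nhop {lam Λ As μ Wp τs πs Δ1 τ π x c W1 : ℝ} (hlam : 1 < lam)
    (hlam2 : lam ≤ 3 / 2) (hAs : 0 < As) (hμ : Λ = μ * As) (hμ0 : 0 < μ) (hWp0 : 0 < Wp)
    (hWp : Wp ≤ 11 / 10 * As) (hτs : τs ≤ 5819 / 10000 * μ) (hπs : πs ≤ 2 / 10000 * μ)
    (hxτ : x ≤ τ) (hx : 5 / 11 * μ ≤ x) (hπ : 0 ≤ π)
    (hΔ1 : Δ1 ≤ 10497 / 10000 * (c / (lam * W1))) (hW1 : 8594 / 10000 * As ≤ W1)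
    (hc0 : 0 ≤ c) (hc : c ≤ 50001 / 100000 * Λ) :
    lam * Wp * (τs + πs + Δ1 - (τ + π)) ≤ 9 / 10 * Λ := by
  have hlam0 : 0 < lam := by linarith
  have hW10 : 0 < W1 := by linarith
  have hlne := hlam0.ne'
  have hWne := hW10.ne'
  have hΛ0 : 0 ≤ Λ := by rw [hμ]; positivity
  have hlW : 0 ≤ lam * Wp := by positivity
  have h2 : lam * Wp * Δ1 ≤ 673 / 1000 * Λ := by
    calc lam * Wp * Δ1 ≤ lam * Wp * (10497 / 10000 * (c / (lam * W1))) :=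
          mul_le_mul_of_nonneg_left hΔ1 hlW
      _ = 10497 / 10000 * (Wp * c) / W1 := by field_simp
      _ ≤ 10497 / 10000 * (11 / 10 * As * (50001 / 100000 * Λ)) / W1 := by gcongr
      _ ≤ 673 / 1000 * Λ := by
          rw [div_le_iff₀ hW10]
          nlinarith [mul_le_mul_of_nonneg_left hW1 hΛ0]
  have h1 : τs + πs + Δ1 - (τ + π) ≤ 1276 / 10000 * μ + Δ1 := by linarith
  calc lam * Wp * (τs + πs + Δ1 - (τ + π)) ≤ lam * Wp * (1276 / 10000 * μ + Δ1) :=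
        mul_le_mul_of_nonneg_left h1 hlW
    _ = lam * Wp * (1276 / 10000 * μ) + lam * Wp * Δ1 := by ring
    _ ≤ 3 / 2 * (11 / 10 * As) * (1276 / 10000 * μ) + 673 / 1000 * Λ :=
        add_le_add (mul_le_mul_of_nonneg_right (mul_le_mul hlam2 hWp hWp0.le (by norm_num))
          (by positivity)) h2
    _ ≤ 9 / 10 * Λ := by rw [hμ]; nlinarith [mul_pos hμ0 hAs]

/-- PRE-GATE BUDGET, abstract form: `lam (A+4) t₃(A) ≤ 0.85 Λ` from `t₃ ≤ 1.0473 x + π`,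
`x A ≤ 0.50001 Λ`, `π A ≤ 0.00016 Λ`. [folklore] -/
theorem clockBox_pregate {lam Λ A x τ π : ℝ} (hlam2 : lam ≤ 3 / 2) (h4 : 40000 ≤ A)
    (hx1 : x ≤ 451 / 10000) (hτ0 : 0 ≤ τ) (hτ : τ ≤ 10473 / 10000 * x)
    (hxA : x * A ≤ 50001 / 100000 * Λ) (hπ0 : 0 ≤ π) (hπA : π * A ≤ 16 / 100000 * Λ)
    (hΛ : 50000000 ≤ Λ) : lam * (A + 4) * (τ + π) ≤ 17 / 20 * Λ := by
  have hA0 : 0 < A := by linarith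
  have hπ1 : π ≤ π * A / 40000 := by
    rw [le_div_iff₀ (by norm_num)]; exact mul_le_mul_of_nonneg_left h4 hπ0
  have hτA : τ * A ≤ 10473 / 10000 * (x * A) := by nlinarith
  have h1 : (A + 4) * (τ + π) ≤ 524 / 1000 * Λ + 1 := by nlinarith
  calc lam * (A + 4) * (τ + π) = lam * ((A + 4) * (τ + π)) := by ring
    _ ≤ 3 / 2 * (524 / 1000 * Λ + 1) := mul_le_mul hlam2 h1 (by positivity) (by norm_num)
    _ ≤ 17 / 20 * Λ := by linarith

/-- `lam W⁺ Δ⁺ ≤ 0.55 Λ + 100`, abstract form: `W⁺ = W⁻ + J`, `0 ≤ J ≤ Λ/1000`, `W⁻ ≥ 0.8594 A⋆`,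
`Λ ≤ 0.0811 A⋆`, `c⁺ ≤ Λ/2 + 73`, `Δ⁺ ≤ 1.0497 c⁺/(lam W⁻)`. [folklore] -/
theorem clockBox_wdelta {lam Λ As Wm J c Δ : ℝ} (hlam : 0 < lam) (hAs : 0 < As)
    (hΛAs : Λ ≤ 811 / 10000 * As) (hΛ0 : 0 ≤ Λ) (hWm : 8594 / 10000 * As ≤ Wm)
    (hJ0 : 0 ≤ J) (hJ : J ≤ Λ / 1000) (hc0 : 0 ≤ c) (hc : c ≤ Λ / 2 + 73)
    (hΔ : Δ ≤ 10497 / 10000 * (c / (lam * Wm))) :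
    lam * (Wm + J) * Δ ≤ 11 / 20 * Λ + 100 := by
  have hWm0 : 0 < Wm := by linarith
  have hlne := hlam.ne'
  have hWne := hWm0.ne'
  calc lam * (Wm + J) * Δ ≤ lam * (Wm + J) * (10497 / 10000 * (c / (lam * Wm))) :=
        mul_le_mul_of_nonneg_left hΔ (by positivity)
    _ = 10497 / 10000 * ((Wm + J) * c) / Wm := by field_simp
    _ ≤ 11 / 20 * Λ + 100 := by
        rw [div_le_iff₀ hWm0]
        have hJc : J * c ≤ Λ / 1000 * c := mul_le_mul_of_nonneg_right hJ hc0
        have hΛW : Λ ≤ 944 / 10000 * Wm := by linarith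
        nlinarith [mul_le_mul_of_nonneg_left hc hWm0.le, mul_le_mul_of_nonneg_right hΛW hc0,
          mul_nonneg hWm0.le hΛ0]

/-- Continuity of `T₁(A) = t₃(A) + Δ⁻(A)` at a point where no denominator or log argument vanishes.
[folklore] -/
theorem clockBox_cont1 {lam ν q Λ A : ℝ} (h1 : A ≠ 0) (h2 : A / 8 ≠ 0)
    (h3 : 1 - ((Λ / 2 + Real.log (A / 8)) + 11 / 5) / A ≠ 0)
    (h4 : lam * (A - (Λ / 2 + Real.log (A / 8)) + 903 + 50 * Real.log A) ≠ 0)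
    (h5 : 1 - ν * (Λ / 2 - Real.log q - 28 * Real.log A - 449) /
        (lam * (A - (Λ / 2 + Real.log (A / 8)) + 903 + 50 * Real.log A)) ≠ 0) :
    ContinuousAt (fun A : ℝ => (((-Real.log (1 - (((Λ) / 2 + Real.log (A / 8)) + 11 / 5) / A)) +
      (250 + 16 * Real.log A) / A) + (-(1 / ν) * Real.log (1 - ν * ((Λ) / 2 - Real.log q -
      28 * Real.log A - 449) / (lam * (A - ((Λ) / 2 + Real.log (A / 8)) + 903 +
      50 * Real.log A)))))) A := by
  fun_prop (disch := assumption)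

/-- Continuity of `T₂(A) = t₃(A) + Δ⁺(A)` at a point where no denominator or log argument vanishes.
[folklore] -/
theorem clockBox_cont2 {lam ν q Λ A : ℝ} (h1 : A ≠ 0) (h2 : A / 8 ≠ 0)
    (h3 : 1 - ((Λ / 2 + Real.log (A / 8)) + 11 / 5) / A ≠ 0)
    (h4 : lam * (A - (Λ / 2 + Real.log (A / 8)) - 903 - 50 * Real.log A) ≠ 0)
    (h5 : 1 - ν * (Λ / 2 - Real.log q + 73) /
        (lam * (A - (Λ / 2 + Real.log (A / 8)) - 903 - 50 * Real.log A)) ≠ 0) :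
    ContinuousAt (fun A : ℝ => (((-Real.log (1 - (((Λ) / 2 + Real.log (A / 8)) + 11 / 5) / A)) +
      (250 + 16 * Real.log A) / A) + (-(1 / ν) * Real.log (1 - ν * ((Λ) / 2 - Real.log q + 73) /
      (lam * (A - ((Λ) / 2 + Real.log (A / 8)) - 903 - 50 * Real.log A)))))) A := by
  fun_prop (disch := assumption)

end Summit.NavierStokesRegularity.NavierStokesRegularity.Theorems.PerpetualPumpCircuitPump
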